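import Literature.NumberTheory.GelbartRogawski1991.LocalConjugateSection
import Literature.RepresentationTheory.HeisenbergGroup.SchrodingerBigCellConjugate
import Literature.RepresentationTheory.HeisenbergGroup.SchrodingerLeraySectionGram
import HarnessLib

/-!
# The big-cell scalar of the CONJUGATE SECTION of a scale-transported section: `λ_{s̄}(k) = conj λ_{s′}(scaleInl k)`

Topic `NumberTheory/GelbartRogawski1991`; namespace `Literature.NumberTheory.GelbartRogawski1991.UnitaryDualPair.LocalSplitting` (that of ★
`LocalScaleModelTransport`, ★ `LocalConjugateSection`).  THEOREMS ONLY (no definition, no named fact, no `sorry`, no instance, no notation).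
Cell `hodgecm-mathlib`, road «L1 pin» (P) of [Liu2021, Lem. D.1 (1)] (LD2-plan (g2) DEALS #1b, brick (F2)); `--supports stmt-HodgeConjecture-24832`.

SETTING: `E/F` quadratic (`c`, `δ`, `c δ = −δ`, `δ² = d`), symmetric invertible `T` and `T′ = a•T` (`J = T ⊗ 1`, `J′ = T′ ⊗ 1`), a finite place `v`,
the Schrödinger models `ρ_T`, `ρ_{T′}` on `𝒮(F_vᴺ)`, Weil's big-cell operator `r = bigCellOp` of the STANDARD model (read through
`e_T = gramProd 𝕋_v : (x, y) ↦ (x, 𝕋_v y)`, as in ★ `RankOneTorusTraceExplicit`: `ω_s(u) = λ · r(e_T ι(u) e_T⁻¹)`), a section `s′` over `ι^{T′}_δ` on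
`U(J′)(F_v)`, its scale transport `š = scaleTransportSection s′` over `ι^T_{δ/a}` on `U(J)(F_v)` (★ `LocalScaleModelTransport`: SAME operators) and a
conjugate section `s̄` of `š` over `ι^T_{−δ/a}` (★ `exists_conjSection`: `toOp (s̄ k) = conj ∘ toOp (š k) ∘ conj`).

* §1 SCALE: `e_{T′} = e_T ∘ e′_a` (`gramProd_of_eq_smul_apply`), whence **`e_{T′} ι^{T′}_δ(scaleInl k) e_{T′}⁻¹ = e_T ι^T_{δ/a}(k) e_T⁻¹`** in the standard
  symplectic group (`symplecticConj_gramProd_iota_scaleInl`, over ★ `symplecticConj_lineScale_iota_scaleInl`): the element of `Sp(F_v^{2N})` whose `r` is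
  compared with `ω` does not change under the scale transport, so NEITHER DOES THE SCALAR (`toRep_scaleTransport_eq_smul_bigCellOp`).
* §2 CONJ: **`e_T ι^T_{−δ}(k) e_T⁻¹ = D₀ (e_T ι^T_δ(k) e_T⁻¹) D₀`**, `D₀ = (x, y) ↦ (x, −y)` (`symplecticConj_gramProd_iota_neg_apply`, over ★ `coe_iota_neg_scaleInl` +
  ★ `symplecticConj_lineScale_iota_scaleInl` at `a = −1`) — the hypothesis `hg′` of ★ `conjOp_bigCellOp`.
* §3 HEAD **`toRep_conjSection_eq_conj_smul_bigCellOp`**: if `ω_{s′}(scaleInl k) = λ · r(e_{T′} ι^{T′}_δ(scaleInl k) e_{T′}⁻¹)` (big cell), then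
  `ω_{s̄}(k) = conj λ · r(e_T ι^T_{−δ/a}(k) e_T⁻¹)` — by ★ `toRep_conjSection_conjSB`, ★ `toRep_scaleTransportSection`, antilinearity ★ `conjSB_smul` and
  ★ `conjOp_bigCellOp` (`conj ∘ r(g) ∘ conj = r(D₀ g D₀)` EXACTLY, no scalar).

This is the transport of the «THE scalar `λ`» slot of ★ `rankOne_torusTrace_eq_explicit` along the second block of the see-saw of ★
`rankOne_theta_anisotropicPlane_dichotomy` (`s̄₂ = conjSection (scaleTransportSection (restrictRight s))`); the value of `λ` for the CM section itself is
brick (F1) (Kudla's cocycle, not here).  HC_CM is proved only modulo the printed citations (2 remaining named inputs hLiu418 = stmt-HodgeConjecture-24832,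
h413 = 24833) until rung 0 closes; count-neutral.

## References
* [MoeglinVignerasWaldspurger1987] C. Mœglin, M.-F. Vignéras, J.-L. Waldspurger, LNM 1291 (1987), Chap. 2 II.1 (A)–(B) and Remarque; Chap. 1 I.17.
* [Weil1964] A. Weil, Acta Math. 111 (1964), n° 13 (29) p. 160, n° 34 p. 182.
* [GelbartRogawski1991] S. Gelbart, J. Rogawski, Invent. Math. 105 (1991), §3.1 p. 454.
* [HarrisKudlaSweet1996] M. Harris, S. Kudla, W. J. Sweet, J. AMS 9 (1996), §1 (1.4), (1.9).
-/

set_option autoImplicit false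

noncomputable section

open scoped Matrix ComplexConjugate
open NumberField IsDedekindDomain MeasureTheory
open Literature.RepresentationTheory.HeisenbergGroup
open Literature.NumberTheory.Automorphic Literature.NumberTheory.Automorphic.UnitaryGroup

namespace Literature.NumberTheory.GelbartRogawski1991.UnitaryDualPair.LocalSplitting

variable (F E : Type) [Field F] [NumberField F] [Field E] [NumberField E] [Algebra F E]
  [Algebra.IsQuadraticExtension F E] (c : E ≃ₐ[F] E) (N : ℕ)
  {δ : E} (hcδ : c δ = -δ) (hδ : δ ≠ 0) {d : F} (hd : δ * δ = algebraMap F E d)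
  (T T' : Matrix (Fin N) (Fin N) F) (hT : T.IsSymm) (hT' : T'.IsSymm) (hTd : IsUnit T.det) (hT'd : IsUnit T'.det)
  (a : Fˣ) (hTT' : T' = (a : F) • T)
  {J J' : Matrix (Fin N) (Fin N) E} (hJ : J = T.map (algebraMap F E)) (hJ' : J' = T'.map (algebraMap F E))
  (v : HeightOneSpectrum (𝓞 F))

/-! ## §1 SCALE: `e_{T′} = e_T ∘ e′_a`, and the standard-model element of `ι^{T′}_δ(scaleInl k)` is that of `ι^T_{δ/a}(k)` -/

omit [NumberField E] [Algebra.IsQuadraticExtension F E] in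
include hTT' in
/-- **`e_{T′} = e_T ∘ e′_a`** pointwise: `(x, 𝕋′_v y) = (x, 𝕋_v (a y))`. [cite: Weil1964, n° 34, p. 182] -/
theorem gramProd_of_eq_smul_apply (w : (Fin N → v.adicCompletion F) × (Fin N → v.adicCompletion F)) :
    gramProd (localGram F N T' v) (UnitaryGroup.isUnit_det_map (algebraMap F (v.adicCompletion F)) hT'd) w =
      gramProd (localGram F N T v) (UnitaryGroup.isUnit_det_map (algebraMap F (v.adicCompletion F)) hTd) (lineScale (unitAt F a v) w) := by
  rw [gramProd_apply, gramProd_apply, lineScale_apply]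
  dsimp only
  rw [localGram_of_eq_smul F N T T' a hTT' v, Matrix.smul_mulVec, Matrix.mulVec_smul, Units.val_mk0]

omit [NumberField E] [Algebra.IsQuadraticExtension F E] in
include hTT' in
/-- the same for the inverses: `e_{T′}⁻¹ = e′_a⁻¹ ∘ e_T⁻¹`. [cite: Weil1964, n° 34, p. 182] -/
theorem gramProd_of_eq_smul_symm_apply (w : (Fin N → v.adicCompletion F) × (Fin N → v.adicCompletion F)) :
    (gramProd (localGram F N T' v) (UnitaryGroup.isUnit_det_map (algebraMap F (v.adicCompletion F)) hT'd)).symm w =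
      (lineScale (unitAt F a v)).symm
        ((gramProd (localGram F N T v) (UnitaryGroup.isUnit_det_map (algebraMap F (v.adicCompletion F)) hTd)).symm w) := by
  apply (gramProd (localGram F N T' v) (UnitaryGroup.isUnit_det_map (algebraMap F (v.adicCompletion F)) hT'd)).injective
  rw [LinearEquiv.apply_symm_apply, gramProd_of_eq_smul_apply F N T T' hTd hT'd a hTT' v, LinearEquiv.apply_symm_apply,
    LinearEquiv.apply_symm_apply]

omit [NumberField E] [Algebra.IsQuadraticExtension F E] in
include hTT' in
/-- **conjugation by `e_{T′}` = conjugation by `e′_a`, then by `e_T`** on `Sp(β_{T′})`. [cite: Weil1964, n° 5, p. 150; n° 34, p. 182] -/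
theorem symplecticConj_gramProd_of_eq_smul (g : LocalSp F N T' v) :
    symplecticConj (gramProd (localGram F N T' v) (UnitaryGroup.isUnit_det_map (algebraMap F (v.adicCompletion F)) hT'd))
        (polar_dotProductBilin_gramProd (localGram F N T' v) (UnitaryGroup.isUnit_det_map (algebraMap F (v.adicCompletion F)) hT'd)) g =
      symplecticConj (gramProd (localGram F N T v) (UnitaryGroup.isUnit_det_map (algebraMap F (v.adicCompletion F)) hTd))
        (polar_dotProductBilin_gramProd (localGram F N T v) (UnitaryGroup.isUnit_det_map (algebraMap F (v.adicCompletion F)) hTd))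
        (symplecticConj (lineScale (unitAt F a v)) (polar_localPairing_lineScale_of_eq_smul F N T T' a hTT' v) g) := by
  apply Subtype.ext
  refine LinearEquiv.ext fun w => ?_
  rw [symplecticConj_apply, symplecticConj_apply, symplecticConj_apply, gramProd_of_eq_smul_apply F N T T' hTd hT'd a hTT' v,
    gramProd_of_eq_smul_symm_apply F N T T' hTd hT'd a hTT' v]

include hTT' in
/-- **`e_{T′} ι^{T′}_δ(scaleInl k) e_{T′}⁻¹ = e_T ι^T_{δ/a}(k) e_T⁻¹`** in the standard symplectic group of `F_v^{2N}`: the scale transport does not move the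
element whose big-cell operator is compared with `ω`. [cite: MoeglinVignerasWaldspurger1987, Chap. 1 I.17; GelbartRogawski1991, §3.1 p. 454] -/
theorem symplecticConj_gramProd_iota_scaleInl (k : localPi E c N J v) :
    symplecticConj (gramProd (localGram F N T' v) (UnitaryGroup.isUnit_det_map (algebraMap F (v.adicCompletion F)) hT'd))
        (polar_dotProductBilin_gramProd (localGram F N T' v) (UnitaryGroup.isUnit_det_map (algebraMap F (v.adicCompletion F)) hT'd))
        (iota F E c N hcδ hδ hd T' hT' hJ' v (scaleInl F E c N T T' a hTT' hJ hJ' v k)) =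
      symplecticConj (gramProd (localGram F N T v) (UnitaryGroup.isUnit_det_map (algebraMap F (v.adicCompletion F)) hTd))
        (polar_dotProductBilin_gramProd (localGram F N T v) (UnitaryGroup.isUnit_det_map (algebraMap F (v.adicCompletion F)) hTd))
        (iota F E c N (conj_lineDelta hcδ a) (lineDelta_ne_zero hδ a) (lineDelta_mul_self hd a) T hT hJ v k) := by
  rw [symplecticConj_gramProd_of_eq_smul F N T T' hTd hT'd a hTT' v,
    symplecticConj_lineScale_iota_scaleInl F E c N hcδ hδ hd T T' hT hT' a hTT' hJ hJ' v k]

/-! ## §2 CONJ: the standard-model element of `ι^T_{−δ}(k)` is the `D₀`-conjugate of that of `ι^T_δ(k)` -/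

/-- **`e_T ι^T_{−δ}(k) e_T⁻¹ = D₀ (e_T ι^T_δ(k) e_T⁻¹) D₀`**, `D₀ = (x, y) ↦ (x, −y)`, written as the hypothesis `hg′` of ★ `conjOp_bigCellOp`:
`(e_T ι^T_{−δ}(k) e_T⁻¹)(x, y) = (((e_T ι^T_δ(k) e_T⁻¹)(x, −y))₁, −((e_T ι^T_δ(k) e_T⁻¹)(x, −y))₂)`.
[cite: MoeglinVignerasWaldspurger1987, Chap. 2 II.1 Remarque; Chap. 1 I.17] [cite: HarrisKudlaSweet1996, §1 (1.4)] -/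
theorem symplecticConj_gramProd_iota_neg_apply (k : localPi E c N J v) (x y : Fin N → v.adicCompletion F) :
    (symplecticConj (gramProd (localGram F N T v) (UnitaryGroup.isUnit_det_map (algebraMap F (v.adicCompletion F)) hTd))
        (polar_dotProductBilin_gramProd (localGram F N T v) (UnitaryGroup.isUnit_det_map (algebraMap F (v.adicCompletion F)) hTd))
        (iota F E c N (conj_lineDelta hcδ (-1)) (lineDelta_ne_zero hδ (-1)) (lineDelta_mul_self hd (-1)) T hT hJ v k)).1 (x, y) =
      (Prod.fst ((symplecticConj (gramProd (localGram F N T v) (UnitaryGroup.isUnit_det_map (algebraMap F (v.adicCompletion F)) hTd))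
          (polar_dotProductBilin_gramProd (localGram F N T v) (UnitaryGroup.isUnit_det_map (algebraMap F (v.adicCompletion F)) hTd))
          (iota F E c N hcδ hδ hd T hT hJ v k)).1 (x, -y)),
        -Prod.snd ((symplecticConj (gramProd (localGram F N T v) (UnitaryGroup.isUnit_det_map (algebraMap F (v.adicCompletion F)) hTd))
          (polar_dotProductBilin_gramProd (localGram F N T v) (UnitaryGroup.isUnit_det_map (algebraMap F (v.adicCompletion F)) hTd))
          (iota F E c N hcδ hδ hd T hT hJ v k)).1 (x, -y))) := by
  -- `ι^T_{−δ}(k) = e′_{−1} ι^{−T}_δ(scaleInl k) e′_{−1}⁻¹` and `ι^{−T}_δ(scaleInl k)` has the linear map of `ι^T_δ(k)`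
  have h1 := symplecticConj_lineScale_iota_scaleInl F E c N hcδ hδ hd T (-T) hT (isSymm_neg_of_isSymm F N T hT) (-1)
    (neg_eq_units_neg_one_smul F N T) hJ (neg_herm_eq_map F E N T hJ) v k
  have h2 := coe_iota_neg_scaleInl F E c N hcδ hδ hd T hT hJ v k
  -- `e′_{−1} = e′_{−1}⁻¹ = D₀`
  have hu : ((unitAt F (-1 : Fˣ) v : (v.adicCompletion F)ˣ) : v.adicCompletion F) = -1 := by
    rw [Units.val_mk0, Units.val_neg, Units.val_one, map_neg, map_one]
  have hfwd : ∀ p : (Fin N → v.adicCompletion F) × (Fin N → v.adicCompletion F),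
      lineScale (unitAt F (-1 : Fˣ) v) p = (p.1, -p.2) := fun p => by
    rw [lineScale_apply, hu, neg_one_smul]
  have hinv : ∀ p : (Fin N → v.adicCompletion F) × (Fin N → v.adicCompletion F),
      (lineScale (unitAt F (-1 : Fˣ) v)).symm p = (p.1, -p.2) := fun p => by
    rw [LinearEquiv.symm_apply_eq, hfwd, neg_neg]
  -- `e_T` commutes with `D₀`
  have hgram : ∀ p : (Fin N → v.adicCompletion F) × (Fin N → v.adicCompletion F),
      gramProd (localGram F N T v) (UnitaryGroup.isUnit_det_map (algebraMap F (v.adicCompletion F)) hTd) (p.1, -p.2) =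
        ((gramProd (localGram F N T v) (UnitaryGroup.isUnit_det_map (algebraMap F (v.adicCompletion F)) hTd) p).1,
          -(gramProd (localGram F N T v) (UnitaryGroup.isUnit_det_map (algebraMap F (v.adicCompletion F)) hTd) p).2) := fun p => by
    rw [gramProd_apply, gramProd_apply, Matrix.mulVec_neg]
  have hsymm : (gramProd (localGram F N T v) (UnitaryGroup.isUnit_det_map (algebraMap F (v.adicCompletion F)) hTd)).symm (x, -y) =
      (((gramProd (localGram F N T v) (UnitaryGroup.isUnit_det_map (algebraMap F (v.adicCompletion F)) hTd)).symm (x, y)).1,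
        -((gramProd (localGram F N T v) (UnitaryGroup.isUnit_det_map (algebraMap F (v.adicCompletion F)) hTd)).symm (x, y)).2) := by
    apply (gramProd (localGram F N T v) (UnitaryGroup.isUnit_det_map (algebraMap F (v.adicCompletion F)) hTd)).injective
    rw [LinearEquiv.apply_symm_apply, hgram, LinearEquiv.apply_symm_apply]
  rw [← h1]
  simp only [symplecticConj_apply]
  rw [h2, hinv, ← hsymm, hfwd, hgram]

/-! ## §3 HEAD: the scalar of the conjugate section is the conjugate scalar -/

include hTT' in
/-- **THE BIG-CELL SCALAR OF THE CONJUGATE OF A SCALE-TRANSPORTED SECTION.**  Let `s′` be a section over `ι^{T′}_δ` on `U(J′)(F_v)` (`T′ = a•T`),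
`š = scaleTransportSection s′` its transport over `ι^T_{δ/a}` and `s̄` a section with `toOp (s̄ g) = conj ∘ toOp (š g) ∘ conj` (★ `exists_conjSection`,
over `ι^T_{−δ/a}`).  If at `k ∈ U(J)(F_v)` the operator `ω_{s′}(scaleInl k)` is `λ · r(e_{T′} ι^{T′}_δ(scaleInl k) e_{T′}⁻¹)` with the element in the big cell,
then `ω_{s̄}(k) = conj λ · r(e_T ι^T_{−δ/a}(k) e_T⁻¹)` (`r = bigCellOp` for any `ψ`, conductor exponent `m`, Haar measure `μ`).
[cite: MoeglinVignerasWaldspurger1987, Chap. 2 II.1 (A)–(B) and Remarque] [cite: Weil1964, n° 13 (29), p. 160; n° 34, p. 182] -/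
theorem toRep_conjSection_eq_conj_smul_bigCellOp
    {ψ : AddChar (v.adicCompletion F) Circle} (hl : IsLocallyConstant (⇑ψ : v.adicCompletion F → Circle))
    [MeasurableSpace (v.adicCompletion F)] [BorelSpace (v.adicCompletion F)] (μ : Measure (v.adicCompletion F)) [μ.IsAddHaarMeasure]
    {m : ℤ} (hψ : ψ.IsContinuousNontrivial) (hm : ψ.HasConductorExp m)
    (s' : localPi E c N J' v →* LocalMp F N T' v) (hs' : ∀ g, MpPsi.proj _ (s' g) = iota F E c N hcδ hδ hd T' hT' hJ' v g)
    (sbar : localPi E c N J v →* LocalMp F N T v)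
    (hsbar : ∀ g, MpPsi.toOp _ (sbar g) =
      conjOp (MpPsi.toOp _ (scaleTransportSection F E c N hcδ hδ hd T T' hT hT' a hTT' hJ hJ' v s' hs' g)))
    (k : localPi E c N J v)
    (hB : Function.Bijective (blockB (symplecticConj (gramProd (localGram F N T v) (UnitaryGroup.isUnit_det_map (algebraMap F (v.adicCompletion F)) hTd))
        (polar_dotProductBilin_gramProd (localGram F N T v) (UnitaryGroup.isUnit_det_map (algebraMap F (v.adicCompletion F)) hTd))
        (iota F E c N (conj_lineDelta hcδ a) (lineDelta_ne_zero hδ a) (lineDelta_mul_self hd a) T hT hJ v k)).1))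
    (lam : ℂ)
    (hlam : ∀ f : SchwartzBruhat (Fin N → v.adicCompletion F),
      ((MpPsi.toRep (localSchrodinger F N T' v)).comp s') (scaleInl F E c N T T' a hTT' hJ hJ' v k) f =
        lam • bigCellOp hl μ hψ hm
          (symplecticConj (gramProd (localGram F N T' v) (UnitaryGroup.isUnit_det_map (algebraMap F (v.adicCompletion F)) hT'd))
            (polar_dotProductBilin_gramProd (localGram F N T' v) (UnitaryGroup.isUnit_det_map (algebraMap F (v.adicCompletion F)) hT'd))
            (iota F E c N hcδ hδ hd T' hT' hJ' v (scaleInl F E c N T T' a hTT' hJ hJ' v k))) f)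
    (f : SchwartzBruhat (Fin N → v.adicCompletion F)) :
    ((MpPsi.toRep (localSchrodinger F N T v)).comp sbar) k f =
      conj lam • bigCellOp hl μ hψ hm
        (symplecticConj (gramProd (localGram F N T v) (UnitaryGroup.isUnit_det_map (algebraMap F (v.adicCompletion F)) hTd))
          (polar_dotProductBilin_gramProd (localGram F N T v) (UnitaryGroup.isUnit_det_map (algebraMap F (v.adicCompletion F)) hTd))
          (iota F E c N (conj_lineDelta (conj_lineDelta hcδ a) (-1)) (lineDelta_ne_zero (lineDelta_ne_zero hδ a) (-1))
            (lineDelta_mul_self (lineDelta_mul_self hd a) (-1)) T hT hJ v k)) f := by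
  -- `ω_{s̄}(k) f = conj (ω_{š}(k) (conj f)) = conj (ω_{s′}(scaleInl k) (conj f))`
  have h1 := toRep_conjSection_conjSB F E c N v _ sbar hsbar k (conjSB f)
  rw [conjSB_conjSB] at h1
  rw [h1]
  have h2 : ((MpPsi.toRep (localSchrodinger F N T v)).comp
      (scaleTransportSection F E c N hcδ hδ hd T T' hT hT' a hTT' hJ hJ' v s' hs')) k (conjSB f) =
      ((MpPsi.toRep (localSchrodinger F N T' v)).comp s') (scaleInl F E c N T T' a hTT' hJ hJ' v k) (conjSB f) := by
    rw [omega_scaleTransportSection]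
    rfl
  rw [h2, hlam, conjSB_smul, symplecticConj_gramProd_iota_scaleInl F E c N hcδ hδ hd T T' hT hT' hTd hT'd a hTT' hJ hJ' v k,
    ← conjOp_apply,
    conjOp_bigCellOp hl μ hψ hm _ _ (symplecticConj_gramProd_iota_neg_apply F E c N (conj_lineDelta hcδ a) (lineDelta_ne_zero hδ a)
      (lineDelta_mul_self hd a) T hT hTd hJ v k) hB]

end Literature.NumberTheory.GelbartRogawski1991.UnitaryDualPair.LocalSplitting

end
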